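import Summits.Ventures.WeilGRH.DualTrigUniversalCells
import Summits.Ventures.WeilGRH.UniformConductorFloorCellsEightyFloors
import Summits.Ventures.WeilGRH.DualTrigUniversalEvenLog8HalfQ16
import Summits.Ventures.WeilGRH.DualTrigUniversalOddLog8HalfQ6
import HarnessLib

/-!
# Weil positivity at `t = 1` for EVERY Dirichlet character of EVERY modulus `q ≥ 129`, and every ODD character of every
# modulus `q ≥ 49` (archimedean certificates at the LP-tight constants × the `J = 80` cell certificate)

Cell `rh-explicit`, WEIL TRACK — GRH ARM (weil-grh-3 route B × weil-grh-1 uniform floors), weil-grh-3 gen5.  The JOINT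
floor of `DualTrigUniversalCells.lean` with the archimedean-only kernel certificates RE-CUT at the LP-tight constants,
`ucert_even_8q16` (`q_c = 16`, `DualTrigUniversalEvenLog8HalfQ16.lean`) and `ucert_odd_8q6` (`q_c = 6`,
`DualTrigUniversalOddLog8HalfQ6.lean`), and the `t = 1`, `J = 80` cell certificate `one80` of weil-grh-1
(`UniformConductorFloorCellsEightyFloors.lean`, `ρ = 10433/5000 = 2.0866`):

* every EVEN character of modulus `q ≥ 129` (`log 16 + 2.0866 = 4.8592 ≤ log 129 = 4.8598`; exact `16·e^ρ = 128.9`),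
* every ODD character of modulus `q ≥ 49` (`log 6 + 2.0866 = 3.8784 ≤ log 49 = 3.8918`; exact `6·e^ρ = 48.3`),

hence `WeilPositivityOnChar χ 1` for EVERY character of every modulus `q ≥ 129` — vs `144 / 56` (the same cells with
weil-grh-1's two Lévy layers, `UniformConductorFloorCellsEightyFloors.lean`), `155 / 61` (gen4 constants `18 / 7` × `one40`)
and the exact pseudo-key floors `75 / 30` (K(t)-closure data; finite sections of two engines).  The archimedean factor is now
within `3 %` of the archimedean bottom on `C(t)`; what remains between `129` and `75` is the factorisation itself (separate
archimedean and prime extremals) — weil-grh-1's joint cells remove it.  No named facts, no `sorry`; no kernel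
evaluation in this file (the certificates are imported).
-/

namespace Summit.Ventures.WeilGRH

open Literature.NumberTheory.LFunctions UniformFloor

/-- `log 16 + 2.0866 ≤ log 129` (`129 = 2⁷ · 129/128`, `log(129/128) ≥ 1/129`). [folklore] -/
theorem log_129_ge : Real.log ((16 : ℕ) : ℝ) + 10433 / 5000 ≤ Real.log ((129 : ℕ) : ℝ) := by
  have h2 := Real.log_two_gt_d9; have h2' := Real.log_two_lt_d9
  have e16 : Real.log ((16 : ℕ) : ℝ) = 4 * Real.log 2 := by
    rw [show ((16 : ℕ) : ℝ) = 2 ^ 4 by norm_num, Real.log_pow]; push_cast; ring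
  have e129 : Real.log ((129 : ℕ) : ℝ) = 7 * Real.log 2 + Real.log (129 / 128) := by
    rw [show ((129 : ℕ) : ℝ) = 2 ^ 7 * (129 / 128) by norm_num, Real.log_mul (by norm_num) (by norm_num), Real.log_pow]
    push_cast; ring
  have h129 : 1 - (129 / 128 : ℝ)⁻¹ ≤ Real.log (129 / 128) := Real.one_sub_inv_le_log_of_pos (by norm_num)
  rw [e16, e129]
  norm_num at h129 ⊢
  linarith

/-- `log 6 + 2.0866 ≤ log 49` (`49 = 2⁴ · 3 · 49/48`, `log(49/48) ≥ 1/49`). [folklore] -/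
theorem log_49_ge : Real.log ((6 : ℕ) : ℝ) + 10433 / 5000 ≤ Real.log ((49 : ℕ) : ℝ) := by
  have h2 := Real.log_two_gt_d9; have h2' := Real.log_two_lt_d9
  have h3 := Real.log_three_gt_d9; have h3' := Real.log_three_lt_d9
  have e6 : Real.log ((6 : ℕ) : ℝ) = Real.log 2 + Real.log 3 := by
    rw [show ((6 : ℕ) : ℝ) = 2 * 3 by norm_num, Real.log_mul (by norm_num) (by norm_num)]
  have e49 : Real.log ((49 : ℕ) : ℝ) = 4 * Real.log 2 + Real.log 3 + Real.log (49 / 48) := by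
    rw [show ((49 : ℕ) : ℝ) = 2 ^ 4 * 3 * (49 / 48) by norm_num, Real.log_mul (by norm_num) (by norm_num),
      Real.log_mul (by norm_num) (by norm_num), Real.log_pow]
    push_cast; ring
  have h49 : 1 - (49 / 48 : ℝ)⁻¹ ≤ Real.log (49 / 48) := Real.one_sub_inv_le_log_of_pos (by norm_num)
  rw [e6, e49]
  norm_num at h49 ⊢
  linarith

/-- **`t = 1` for every EVEN Dirichlet character of every modulus `q ≥ 129`** (archimedean certificate `ucert_even_8q16` ×
cell certificate `one80`). [folklore] -/
theorem weilPositivityOnChar_one_of_even_ge_129 {q : ℕ} (hq : 129 ≤ q) (χ : DirichletCharacter ℂ q)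
    (hpar : charParity χ = 0) : WeilPositivityOnChar χ 1 := by
  have hq1 : q ≠ 1 := by omega
  have hlog : Real.log (ucert_even_8q16.q : ℝ) + 10433 / 5000 ≤ Real.log (q : ℝ) := by
    have hmono := Real.log_le_log (by norm_num) (by exact_mod_cast hq : ((129 : ℕ) : ℝ) ≤ (q : ℝ))
    rw [show (ucert_even_8q16.q : ℝ) = ((16 : ℕ) : ℝ) by norm_num [ucert_even_8q16]]
    exact log_129_ge.trans hmono
  exact DKCert.weilPositivityOnChar_universal_of_check_of_cells ucert_even_8q16_check rfl rfl one_pos exp_two_le_eight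
    (by decide) hq1 χ hpar (by norm_num) phiOne80 (by norm_num : (0 : ℝ) < 647 / 2500) one80_philo one80_phihi
    one80_phiout sOne80 one80_shifts wbar7 (wbar7_ge 7 le_rfl) one80_cert hlog

/-- **`t = 1` for every ODD Dirichlet character of every modulus `q ≥ 49`** (archimedean certificate `ucert_odd_8q6` ×
cell certificate `one80`). [folklore] -/
theorem weilPositivityOnChar_one_of_odd_ge_49 {q : ℕ} (hq : 49 ≤ q) (χ : DirichletCharacter ℂ q)
    (hpar : charParity χ = 1) : WeilPositivityOnChar χ 1 := by
  have hq1 : q ≠ 1 := by omega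
  have hlog : Real.log (ucert_odd_8q6.q : ℝ) + 10433 / 5000 ≤ Real.log (q : ℝ) := by
    have hmono := Real.log_le_log (by norm_num) (by exact_mod_cast hq : ((49 : ℕ) : ℝ) ≤ (q : ℝ))
    rw [show (ucert_odd_8q6.q : ℝ) = ((6 : ℕ) : ℝ) by norm_num [ucert_odd_8q6]]
    exact log_49_ge.trans hmono
  exact DKCert.weilPositivityOnChar_universal_of_check_of_cells ucert_odd_8q6_check rfl rfl one_pos exp_two_le_eight
    (by decide) hq1 χ hpar (by norm_num) phiOne80 (by norm_num : (0 : ℝ) < 647 / 2500) one80_philo one80_phihi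
    one80_phiout sOne80 one80_shifts wbar7 (wbar7_ge 7 le_rfl) one80_cert hlog

/-- ★ **Weil positivity on `[−1, 1]` for EVERY Dirichlet character of EVERY modulus `q ≥ 129`.** [folklore] -/
theorem weilPositivityOnChar_one_of_ge_129 {q : ℕ} (hq : 129 ≤ q) (χ : DirichletCharacter ℂ q) :
    WeilPositivityOnChar χ 1 := by
  have hle := charParity_le_one χ
  rcases Nat.lt_or_ge (charParity χ) 1 with h | h
  · exact weilPositivityOnChar_one_of_even_ge_129 hq χ (by omega)
  · exact weilPositivityOnChar_one_of_odd_ge_49 (by omega) χ (by omega)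

end Summit.Ventures.WeilGRH
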